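import Literature.NumberTheory.Rogawski1990.LocalNormFibreNonsplit
import Literature.NumberTheory.Rogawski1990.ExplicitFactorKappaAlmostEverywhereOne
import Literature.NumberTheory.Automorphic.LocalUnitaryGroupUnimodular
import Literature.NumberTheory.Automorphic.AddCharConductorExponent
import Literature.NumberTheory.Automorphic.AdicCompletionResidueCard
import HarnessLib

/-!
# `D_G(γ) = D_{G∕H,v}(γ_H) · D_H(γ_H)` on a matching pair `ι_v(γ_H) ↔ γ` at a finite place: the Weyl discriminant of `U(3)` FACTORS through the
# endoscopic group `H = U(2) × U(1)` [Rogawski1990 §4.9 p. 55 «`D_{G∕H}(γ) = D_G(γ)∕D_H(γ)`»; §12.5 pp. 182–183]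

Topic `NumberTheory/Rogawski1990`; namespace `Literature.NumberTheory.Rogawski1990`.  THEOREMS ONLY (no definition ∕ instance ∕ notation ∕ named fact ∕ `sorry`).
Cell `pub/hodgecm-mathlib`, crux H413 = `stmt-HodgeConjecture-24833` (lane `--supports`, count-neutral); seat F0P3-p02 (g23); brick (N1) «DISC-ID» of the price memo
`F0/P3/F0P3-p02/g23/CENSUS-UPTR.v1.F0P3p02g23.md` (the `up` row's last printed clause `hUpTr` = UpSpec (3), §12.5 p. 183 display ∕ Lemma 12.5.1).

WHAT.  Print defines `D_{G∕H}(γ) = D_G(γ)∕D_H(γ)` [§4.9 p. 55] for `γ = ι(γ_H)`, `γ_H = (g, u) ∈ H = U(2) × U(1)`.  In the tree the three quantities are CLOSED FORMS on the local carriers at a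
finite place `v` of `L⁺` (`R = L ⊗ L⁺_v = Π_{w∣v} L_w`, `N(x) = Π_w |x_w|_w` with ★ `normAbs`):
* `D_G(γ) = √√( N(discr charpoly γ) · N(det γ)⁻² )` — the `eDG` pin of the §12.5 datum (★ `…Rung0Five` `-- eDG`; ★ `F0P3cStCharTSDGField`);
* `D_H(γ_H) = √√( N(discr χ_g) · N(det g)⁻¹ )` — the `eDH` pin (★ `-- eDH`; ★ `F0P3cStCharTSDGFieldTwo`);
* `D_{G∕H,v}(γ_H) = √( Π_w ‖χ_g(u)_w‖ )` — ★ `finWeylRatio` (★ `FinExplicitTransferFactor` §3), the middle factor of Rogawski's explicit transfer factor `Δ‴_v = τ · D_{G∕H} · κ`.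
THIS FILE: on every matching pair `ι_v(γ_H) ↔ γ` (★ `IsLocalNormPair`, any hermitian `H′`, so both `G = U(Φ₃)` and its inner forms), at a place `v` NON-SPLIT in `L`,
  **`D_G(γ) = D_{G∕H,v}(γ_H) · D_H(γ_H)`**  (`weylDiscrThree_eq_finWeylRatio_mul_weylDiscrTwo`),
with NO regularity hypothesis (both sides vanish together off the `G`-regular pairs).  Ingredients: `charpoly γ = χ_g · (X − u)` (★ `IsLocalNormPair.charpoly_eq`); the
polynomial identity `discr(χ · (X − u)) = discr χ · χ(u)²` for a monic quadratic `χ` (§1, Mathlib `discr_of_degree_eq_two∕three` + `ring`); `det γ = det g · u` (constant terms);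
`N(det g) = N(u) = 1` for unitary `g`, `u` at a non-split place (§2: `σ(d)·d = 1` ★ `conjLocal_det_mul_det`, `|σ x|_w = |x|_w` ★ `valued_galAdicCompletionMap`).
USE.  It is the identity that cancels `D_G` against `D_{G∕H} · D_H` when the transfer identity (4.3.1)∕(4.9.1) is inserted into the Weyl integration formulas of `G` and `H`
(Lemma 12.5.1, Prop. 12.5.2∕12.5.3): the (UP-DEF) summand `τ · D_H · κ · α` of `α^G` times `D_G⁻¹` against `Δ‴_v · D_H² = τ · D_G · D_H · κ`.
HONEST LABEL: count-neutral helper; closes no organ.  HC_CM is proved only modulo the 7 printed citations (2 remaining named inputs: hLiu418 = `stmt-HodgeConjecture-24832`,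
h413 = `stmt-HodgeConjecture-24833`) until rung 0 closes.

## References
* [Rogawski1990] J. D. Rogawski, *Automorphic Representations of Unitary Groups in Three Variables*, Ann. of Math. Stud. 123 (1990): §4.9 pp. 54–55 (`D_G`, `D_H`,
  `D_{G∕H} = D_G∕D_H`, `Δ_{G∕H} = τ D_{G∕H}`), §12.5 pp. 182–183 (the Weyl integration formula, `α ↦ α^G`, Lemma 12.5.1).
* [WeilBNT1967] A. Weil, *Basic Number Theory* (1967), Ch. I §2 (normalised absolute values; modules of finite products).
-/

set_option autoImplicit false

noncomputable section

open NumberField IsDedekindDomain Matrix Polynomial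
open scoped NNReal MatrixGroups
open Literature.NumberTheory.GaloisRepresentations Literature.NumberTheory.GaloisRepresentations.IsNonarchimedeanLocalField

namespace Literature.NumberTheory.Rogawski1990

open Literature.NumberTheory.Automorphic Literature.NumberTheory.Automorphic.UnitaryGroup

/-! ## §1 The polynomial identity `discr(χ · (X − u)) = discr χ · χ(u)²` for a monic quadratic `χ` -/

/-- **`discr(χ · (X − u)) = discr(χ) · χ(u)²`** for a MONIC QUADRATIC `χ` over any commutative ring (the discriminant of a product is the product of the discriminants
times the square of the resultant; `Res(χ, X − u) = ± χ(u)`) — by Mathlib's explicit formulas `discr_of_degree_eq_two` ∕ `discr_of_degree_eq_three` and `ring`.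
[cite: Rogawski1990, §4.9 p. 55] -/
theorem discr_mul_X_sub_C_of_monic_of_natDegree_eq_two {R : Type*} [CommRing R] [Nontrivial R] {χ : R[X]} (hm : χ.Monic) (hd : χ.natDegree = 2)
    (u : R) : (χ * (X - C u)).discr = χ.discr * (χ.eval u) ^ 2 := by
  -- `χ = X² + a X + b`
  set a := χ.coeff 1 with ha
  set b := χ.coeff 0 with hb
  have h2 : χ.coeff 2 = 1 := by rw [← hd]; exact hm.coeff_natDegree
  have hχ : χ = X ^ 2 + C a * X + C b := by
    refine Polynomial.ext fun n => ?_
    rcases n with _ | _ | _ | n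
    · simp [hb]
    · simp [ha]
    · simp [h2]
    · have hlt : χ.natDegree < n + 3 := by rw [hd]; omega
      rw [coeff_eq_zero_of_natDegree_lt hlt]
      simp [coeff_X_pow]
  have hdeg2 : χ.degree = 2 := by rw [degree_eq_natDegree hm.ne_zero, hd]; rfl
  -- the product is the monic cubic `X³ + (a − u) X² + (b − a u) X − b u`
  have hprod : χ * (X - C u) = X ^ 3 + C (a - u) * X ^ 2 + C (b - a * u) * X + C (-(b * u)) := by
    rw [hχ]; simp only [map_sub, map_mul, map_neg]; ring
  have hmon3 : (χ * (X - C u)).Monic := hm.mul (monic_X_sub_C u)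
  have hnat3 : (χ * (X - C u)).natDegree = 3 := by
    rw [hm.natDegree_mul (monic_X_sub_C u), hd, natDegree_X_sub_C]
  have hdeg3 : (χ * (X - C u)).degree = 3 := by rw [degree_eq_natDegree hmon3.ne_zero, hnat3]; rfl
  have c3 : (χ * (X - C u)).coeff 3 = 1 := by rw [← hnat3]; exact hmon3.coeff_natDegree
  have c2 : (χ * (X - C u)).coeff 2 = a - u := by
    rw [hprod]; simp only [coeff_add, coeff_C_mul, coeff_X_pow, coeff_X, coeff_C]; norm_num
  have c1 : (χ * (X - C u)).coeff 1 = b - a * u := by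
    rw [hprod]; simp only [coeff_add, coeff_C_mul, coeff_X_pow, coeff_X, coeff_C]; norm_num
  have c0 : (χ * (X - C u)).coeff 0 = -(b * u) := by
    rw [hprod]; simp only [coeff_add, coeff_C_mul, coeff_X_pow, coeff_X, coeff_C]; norm_num
  have hev : χ.eval u = u ^ 2 + a * u + b := by
    rw [hχ]; simp only [eval_add, eval_mul, eval_pow, eval_C, eval_X]
  rw [discr_of_degree_eq_three hdeg3, discr_of_degree_eq_two hdeg2, c3, c2, c1, c0, h2, hev]
  ring

/-! ## §2 `N(x) = Π_{w ∣ v} |x_w|_w` on `R = Π_w L_w`: multiplicativity, and `N = 1` on norm-one elements at a non-split place -/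

section Norms

variable (L : Type) [Field L] [NumberField L] [IsCMField L] (v : HeightOneSpectrum (𝓞 ↥(maximalRealSubfield L)))

omit [IsCMField L] in
/-- `N(x y) = N(x) N(y)` for `N(x) = Π_w |x_w|_w`. [cite: WeilBNT1967, Ch. I §2] -/
theorem prod_normAbs_mul (x y : UnitaryGroup.LocalRing L v) :
    ∏ w : PlacesOver L v, normAbs (w.1.adicCompletion L) ((x * y) w) =
      (∏ w : PlacesOver L v, normAbs (w.1.adicCompletion L) (x w)) * ∏ w : PlacesOver L v, normAbs (w.1.adicCompletion L) (y w) := by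
  rw [← Finset.prod_mul_distrib]
  exact Finset.prod_congr rfl fun w _ => by rw [Pi.mul_apply, map_mul]

omit [IsCMField L] in
/-- `N(x ^ n) = N(x) ^ n`. [cite: WeilBNT1967, Ch. I §2] -/
theorem prod_normAbs_pow (x : UnitaryGroup.LocalRing L v) (n : ℕ) :
    ∏ w : PlacesOver L v, normAbs (w.1.adicCompletion L) ((x ^ n) w) =
      (∏ w : PlacesOver L v, normAbs (w.1.adicCompletion L) (x w)) ^ n := by
  rw [← Finset.prod_pow]
  exact Finset.prod_congr rfl fun w _ => by rw [Pi.pow_apply, map_pow]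

/-- **`|σ(x)_w|_w = |x_w|_w`** at a place `w` fixed by complex conjugation (`σ = c ⊗ 1` acts on `L_w` through ★ `galAdicCompletionMap`, an isometry:
★ `valued_galAdicCompletionMap`). [cite: WeilBNT1967, Ch. I §2] -/
theorem normAbs_conjLocal_apply_of_smul_eq (w : PlacesOver L v) (hw : IsCMField.complexConj L • w.1 = w.1) (x : UnitaryGroup.LocalRing L v) :
    normAbs (w.1.adicCompletion L) (conjLocal L (IsCMField.complexConj L) v x w) = normAbs (w.1.adicCompletion L) (x w) := by
  have h : Valued.v (conjLocal L (IsCMField.complexConj L) v x w) = Valued.v (x w) := by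
    rw [conjLocal_apply_eq_galAdicCompletionMap L v w hw, valued_galAdicCompletionMap]
  exact le_antisymm ((normAbs_le_normAbs_iff_valued w.1 _ _).2 h.le) ((normAbs_le_normAbs_iff_valued w.1 _ _).2 h.ge)

/-- **`N(x) = 1` whenever `σ(x) · x = 1`** at a place `v` NON-SPLIT in `L` (every `w ∣ v` is fixed by `c`): `N(σ x) = N(x)` termwise, so `N(x)² = N(1) = 1`.
[cite: WeilBNT1967, Ch. I §2] -/
theorem prod_normAbs_eq_one_of_conjLocal_mul_self (hns : ∀ w : PlacesOver L v, IsCMField.complexConj L • w.1 = w.1) {x : UnitaryGroup.LocalRing L v}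
    (hx : conjLocal L (IsCMField.complexConj L) v x * x = 1) :
    ∏ w : PlacesOver L v, normAbs (w.1.adicCompletion L) (x w) = 1 := by
  have h := congrArg (fun y : UnitaryGroup.LocalRing L v => ∏ w : PlacesOver L v, normAbs (w.1.adicCompletion L) (y w)) hx
  rw [prod_normAbs_mul, Finset.prod_congr rfl fun w _ => normAbs_conjLocal_apply_of_smul_eq L v w (hns w) x] at h
  have h1 : ∏ w : PlacesOver L v, normAbs (w.1.adicCompletion L) ((1 : UnitaryGroup.LocalRing L v) w) = 1 :=
    Finset.prod_eq_one fun w _ => by rw [Pi.one_apply, map_one]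
  rw [h1] at h
  set P := ∏ w : PlacesOver L v, normAbs (w.1.adicCompletion L) (x w)
  have h' : ((P : ℝ≥0) : ℝ) * (P : ℝ) = 1 := by exact_mod_cast h
  rcases mul_self_eq_one_iff.1 h' with hP | hP
  · exact_mod_cast hP
  · have h0 : (0 : ℝ) ≤ (P : ℝ) := P.coe_nonneg
    linarith

/-- **`N(det x) = 1` on `U(J)(L⁺_v)`** for any `N` and any `J` with `det J` a unit, at a non-split `v` (★ `conjLocal_det_mul_det`). [cite: Rogawski1990, §4.9 p. 54] -/
theorem prod_normAbs_det_eq_one (hns : ∀ w : PlacesOver L v, IsCMField.complexConj L • w.1 = w.1) {N : ℕ} {J : Matrix (Fin N) (Fin N) L}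
    (hJ : IsUnit J.det) (x : (UnitaryGroup.cmDatum L N J).Local v) :
    ∏ w : PlacesOver L v, normAbs (w.1.adicCompletion L) (((x.val : GL (Fin N) (UnitaryGroup.LocalRing L v)).val.det) w) = 1 :=
  prod_normAbs_eq_one_of_conjLocal_mul_self L v hns (conjLocal_det_mul_det (IsCMField.complexConj L) hJ x)

omit [IsCMField L] in
/-- Mathlib's norm on `L_w` is the normalised absolute value (the tree's `norm_eq_coe_normAbs`, reproduced to keep the import closure small). [cite: WeilBNT1967, Ch. I §2] -/
private theorem norm_eq_coe_normAbs' (w : HeightOneSpectrum (𝓞 L)) (x : w.adicCompletion L) : ‖x‖ = ((normAbs (w.adicCompletion L) x : ℝ≥0) : ℝ) := by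
  by_cases hx : x = 0
  · rw [hx, norm_zero, map_zero, NNReal.coe_zero]
  have hv : Valued.v x ≠ 0 := (Valuation.ne_zero_iff _).2 hx
  have hxn : Valued.v x = WithZero.exp (Multiplicative.toAdd (WithZero.unzero hv)) := by
    rw [WithZero.exp, ofAdd_toAdd, WithZero.coe_unzero]
  rw [FinitePlace.norm_def, WithZeroMulInt.toNNReal_neg_apply _ hv,
    normAbs_eq_inv_zpow_of_valued_eq w hxn, residueFieldCard_adicCompletion_eq, _root_.inv_zpow', neg_neg]
  rfl

omit [IsCMField L] in
/-- `Π_w ‖x_w‖ = N(x)` (as a real number). [cite: WeilBNT1967, Ch. I §2] -/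
theorem prod_norm_apply_eq_coe_prod_normAbs (x : UnitaryGroup.LocalRing L v) :
    ∏ w : PlacesOver L v, ‖x w‖ = ((∏ w : PlacesOver L v, normAbs (w.1.adicCompletion L) (x w) : ℝ≥0) : ℝ) := by
  rw [NNReal.coe_prod]
  exact Finset.prod_congr rfl fun w _ => norm_eq_coe_normAbs' L w.1 (x w)

end Norms

/-! ## §3 The factorisation `D_G(γ) = D_{G∕H,v}(γ_H) · D_H(γ_H)` on matching pairs -/

section Factorisation

variable (L : Type) [Field L] [NumberField L] [IsCMField L] (H' : Matrix (Fin 3) (Fin 3) L) (v : HeightOneSpectrum (𝓞 ↥(maximalRealSubfield L)))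

omit [IsCMField L] in
/-- `det Φ₂ = −1` is a unit (`Φ₂ = antidiag(1, 1)`). [cite: Rogawski1990, §4.9 p. 54] -/
theorem isUnit_det_phiTwo : IsUnit (Matrix.of fun i j : Fin 2 => if i.val + j.val + 1 = 2 then (1 : L) else 0).det := by
  have h : (Matrix.of fun i j : Fin 2 => if i.val + j.val + 1 = 2 then (1 : L) else 0) = !![0, 1; 1, 0] := by
    ext i j; fin_cases i <;> fin_cases j <;> rfl
  rw [h, Matrix.det_fin_two_of]; norm_num

omit [IsCMField L] in
/-- `det Φ₁ = 1` is a unit (`Φ₁ = (1)`). [cite: Rogawski1990, §4.9 p. 54] -/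
theorem isUnit_det_phiOne : IsUnit (Matrix.of fun i j : Fin 1 => if i.val + j.val + 1 = 1 then (1 : L) else 0).det := by
  rw [Matrix.det_fin_one, Matrix.of_apply]; simp

/-- `u = det` of the `U(Φ₁)`-coordinate: `finGammaTwo γ_H = det (γ_H.2)` (a `1 × 1` determinant). [cite: Rogawski1990, §4.9 p. 55] -/
theorem finGammaTwo_eq_det
    (γH : (UnitaryGroup.cmDatum L 2 (Matrix.of fun i j : Fin 2 => if i.val + j.val + 1 = 2 then (1 : L) else 0)).Local v ×
      (UnitaryGroup.cmDatum L 1 (Matrix.of fun i j : Fin 1 => if i.val + j.val + 1 = 1 then (1 : L) else 0)).Local v) :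
    finGammaTwo L v γH = ((γH.2.val : GL (Fin 1) (UnitaryGroup.LocalRing L v)).val).det := by
  rw [finGammaTwo, Matrix.det_fin_one]

/-- **`N(u) = 1`** for the `U(Φ₁)`-coordinate `u` of `γ_H` at a non-split `v`. [cite: Rogawski1990, §4.9 p. 55] -/
theorem prod_normAbs_finGammaTwo_eq_one (hns : ∀ w : PlacesOver L v, IsCMField.complexConj L • w.1 = w.1)
    (γH : (UnitaryGroup.cmDatum L 2 (Matrix.of fun i j : Fin 2 => if i.val + j.val + 1 = 2 then (1 : L) else 0)).Local v ×
      (UnitaryGroup.cmDatum L 1 (Matrix.of fun i j : Fin 1 => if i.val + j.val + 1 = 1 then (1 : L) else 0)).Local v) :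
    ∏ w : PlacesOver L v, normAbs (w.1.adicCompletion L) (finGammaTwo L v γH w) = 1 := by
  rw [finGammaTwo_eq_det]
  exact prod_normAbs_det_eq_one L v hns (isUnit_det_phiOne L) γH.2

/-- **`N(det g) = 1`** for the `U(Φ₂)`-coordinate `g` of `γ_H` at a non-split `v`. [cite: Rogawski1990, §4.9 p. 55] -/
theorem prod_normAbs_det_fst_eq_one (hns : ∀ w : PlacesOver L v, IsCMField.complexConj L • w.1 = w.1)
    (γH : (UnitaryGroup.cmDatum L 2 (Matrix.of fun i j : Fin 2 => if i.val + j.val + 1 = 2 then (1 : L) else 0)).Local v ×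
      (UnitaryGroup.cmDatum L 1 (Matrix.of fun i j : Fin 1 => if i.val + j.val + 1 = 1 then (1 : L) else 0)).Local v) :
    ∏ w : PlacesOver L v, normAbs (w.1.adicCompletion L) (((γH.1.val : GL (Fin 2) (UnitaryGroup.LocalRing L v)).val.det) w) = 1 :=
  prod_normAbs_det_eq_one L v hns (isUnit_det_phiTwo L) γH.1

variable {L H' v}

/-- **`discr(charpoly γ) = discr(χ_g) · χ_g(u)²`** on a matching pair `ι_v(γ_H) ↔ γ` (`charpoly γ = χ_g · (X − u)`, ★ `IsLocalNormPair.charpoly_eq`, and §1).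
[cite: Rogawski1990, §4.9 p. 55] -/
theorem IsLocalNormPair.discr_charpoly_eq
    {γH : (UnitaryGroup.cmDatum L 2 (Matrix.of fun i j : Fin 2 => if i.val + j.val + 1 = 2 then (1 : L) else 0)).Local v ×
      (UnitaryGroup.cmDatum L 1 (Matrix.of fun i j : Fin 1 => if i.val + j.val + 1 = 1 then (1 : L) else 0)).Local v}
    {γ : (UnitaryGroup.cmDatum L 3 H').Local v} (h : IsLocalNormPair L H' v γH γ) :
    ((γ.val : GL (Fin 3) (UnitaryGroup.LocalRing L v)).val.charpoly).discr =
      (finCharpolyTwo L v γH).discr * ((finCharpolyTwo L v γH).eval (finGammaTwo L v γH)) ^ 2 := by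
  rw [h.charpoly_eq]
  exact discr_mul_X_sub_C_of_monic_of_natDegree_eq_two (Matrix.charpoly_monic _) (Matrix.charpoly_natDegree_eq_dim _) _

/-- **`det γ = det g · u`** on a matching pair (compare the constant terms of `charpoly γ = χ_g · (X − u)`; `det = (−1)^n · charpoly(0)`).
[cite: Rogawski1990, §4.9 p. 55] -/
theorem IsLocalNormPair.det_eq
    {γH : (UnitaryGroup.cmDatum L 2 (Matrix.of fun i j : Fin 2 => if i.val + j.val + 1 = 2 then (1 : L) else 0)).Local v ×
      (UnitaryGroup.cmDatum L 1 (Matrix.of fun i j : Fin 1 => if i.val + j.val + 1 = 1 then (1 : L) else 0)).Local v}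
    {γ : (UnitaryGroup.cmDatum L 3 H').Local v} (h : IsLocalNormPair L H' v γH γ) :
    (γ.val : GL (Fin 3) (UnitaryGroup.LocalRing L v)).val.det =
      (γH.1.val : GL (Fin 2) (UnitaryGroup.LocalRing L v)).val.det * finGammaTwo L v γH := by
  have h3 := Matrix.det_eq_sign_charpoly_coeff (γ.val : GL (Fin 3) (UnitaryGroup.LocalRing L v)).val
  have h2 := Matrix.det_eq_sign_charpoly_coeff (γH.1.val : GL (Fin 2) (UnitaryGroup.LocalRing L v)).val
  rw [h3, h.charpoly_eq, h2, finCharpolyTwo, mul_coeff_zero, coeff_sub, coeff_X_zero, coeff_C_zero]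
  simp only [Fintype.card_fin]
  ring

/-- **THE FACTORISATION `D_G(γ) = D_{G∕H,v}(γ_H) · D_H(γ_H)`** on every matching pair `ι_v(γ_H) ↔ γ` at a place `v` non-split in `L`, with `D_G`, `D_H` the closed forms
of the §12.5 datum's pins `eDG` ∕ `eDH` (spelled inline, token for token) and `D_{G∕H,v}` = ★ `finWeylRatio`.  No regularity hypothesis.
[cite: Rogawski1990, §4.9 p. 55] -/
theorem weylDiscrThree_eq_finWeylRatio_mul_weylDiscrTwo (hns : ∀ w : PlacesOver L v, IsCMField.complexConj L • w.1 = w.1)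
    {γH : (UnitaryGroup.cmDatum L 2 (Matrix.of fun i j : Fin 2 => if i.val + j.val + 1 = 2 then (1 : L) else 0)).Local v ×
      (UnitaryGroup.cmDatum L 1 (Matrix.of fun i j : Fin 1 => if i.val + j.val + 1 = 1 then (1 : L) else 0)).Local v}
    {γ : (UnitaryGroup.cmDatum L 3 H').Local v} (h : IsLocalNormPair L H' v γH γ) :
    ((NNReal.sqrt (NNReal.sqrt
        ((∏ w : PlacesOver L v, normAbs (w.1.adicCompletion L) (((γ.val : GL (Fin 3) (UnitaryGroup.LocalRing L v)).val.charpoly.discr) w)) *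
          ((∏ w : PlacesOver L v, normAbs (w.1.adicCompletion L) (((γ.val : GL (Fin 3) (UnitaryGroup.LocalRing L v)).val.det) w)) ^ 2)⁻¹)) : ℝ≥0) : ℝ) =
      finWeylRatio L v γH *
        ((NNReal.sqrt (NNReal.sqrt
          ((∏ w : PlacesOver L v, normAbs (w.1.adicCompletion L) (((γH.1.val : GL (Fin 2) (UnitaryGroup.LocalRing L v)).val.charpoly.discr) w)) *
            (∏ w : PlacesOver L v, normAbs (w.1.adicCompletion L) (((γH.1.val : GL (Fin 2) (UnitaryGroup.LocalRing L v)).val.det) w))⁻¹)) : ℝ≥0) : ℝ) := by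
  -- the three norm identities
  have hdet : ∏ w : PlacesOver L v, normAbs (w.1.adicCompletion L) (((γ.val : GL (Fin 3) (UnitaryGroup.LocalRing L v)).val.det) w) = 1 := by
    rw [h.det_eq, prod_normAbs_mul, prod_normAbs_det_fst_eq_one L v hns γH, prod_normAbs_finGammaTwo_eq_one L v hns γH, mul_one]
  have hdisc : ∏ w : PlacesOver L v, normAbs (w.1.adicCompletion L) (((γ.val : GL (Fin 3) (UnitaryGroup.LocalRing L v)).val.charpoly.discr) w) =
      (∏ w : PlacesOver L v, normAbs (w.1.adicCompletion L) ((finCharpolyTwo L v γH).discr w)) *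
        (∏ w : PlacesOver L v, normAbs (w.1.adicCompletion L) (((finCharpolyTwo L v γH).eval (finGammaTwo L v γH)) w)) ^ 2 := by
    rw [h.discr_charpoly_eq, prod_normAbs_mul, prod_normAbs_pow]
  have hdet2 : ∏ w : PlacesOver L v, normAbs (w.1.adicCompletion L) (((γH.1.val : GL (Fin 2) (UnitaryGroup.LocalRing L v)).val.det) w) = 1 :=
    prod_normAbs_det_fst_eq_one L v hns γH
  -- `D_{G∕H,v}` in `ℝ≥0`-currency
  have hW : finWeylRatio L v γH =
      ((NNReal.sqrt (∏ w : PlacesOver L v, normAbs (w.1.adicCompletion L) (((finCharpolyTwo L v γH).eval (finGammaTwo L v γH)) w)) : ℝ≥0) : ℝ) := by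
    rw [finWeylRatio, prod_norm_apply_eq_coe_prod_normAbs, ← Real.coe_sqrt]
  rw [hdet, hdisc, hdet2, hW]
  simp only [one_pow, inv_one, mul_one]
  rw [← NNReal.coe_mul]
  congr 1
  -- `√√(d · c²) = √c · √√d` in `ℝ≥0`
  set d := ∏ w : PlacesOver L v, normAbs (w.1.adicCompletion L) ((finCharpolyTwo L v γH).discr w)
  set c := ∏ w : PlacesOver L v, normAbs (w.1.adicCompletion L) (((finCharpolyTwo L v γH).eval (finGammaTwo L v γH)) w)
  have hχ : (finCharpolyTwo L v γH) = (γH.1.val : GL (Fin 2) (UnitaryGroup.LocalRing L v)).val.charpoly := rfl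
  rw [← hχ, NNReal.sqrt_mul, NNReal.sqrt_sq, NNReal.sqrt_mul, mul_comm]

end Factorisation

end Literature.NumberTheory.Rogawski1990
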